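import Summits.BirchSwinnertonDyer.BirchSwinnertonDyer.Theorems.Rank1ResidualJetKolyvaginDecompositionTrivial
import Summits.BirchSwinnertonDyer.BirchSwinnertonDyer.Theorems.Rank1ResidualJetUnramifiedEigenCount
import Literature.NumberTheory.EllipticCurves.SelmerGaloisActionPlaces
import Literature.AnabelianGeometry.AbsoluteAnabelian.MLFArtinTransport
import HarnessLib

/-!
# T1 JET (cell `bsd-jet`), road K, input (L1) — brick E₂: the `s`-eigenspace of complex conjugation
# `σ_{*,λ} = conjActPlace` on `H¹_ur(K_λ, E[p^k])` is counted on `E[p^k]` through the ADAPTED LIFT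

HONEST FRAMING (programme file `BSD-LIT2PART-PROGRAMME-v1.md` §HONESTY, verbatim): «no tranche here
proves BSD; ARM L moves the LITERAL column of an r ≤ 1 census into the kernel-proved-modulo-named-print
column; ARM P changes what «named print» is worth.» THEOREMS ONLY (seat `bsd-jet-pv-1`, session g6;
`--supports stmt-BirchSwinnertonDyer-14418`, helper): no definition, no named fact, no `sorry`.
Nothing is booked; 0 classes move.

## What

`K` imaginary quadratic, `E = W/ℚ` globally minimal, `p` prime, `ℓ` a Kolyvagin prime of W. Zhang with
`k ≤ M(ℓ)`, `w = λ ∋ ℓ` the (inert) place, `τ ∈ Aut(K/ℚ)` with `τ • w = w`, `L = K_λ`. The local action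
`conjActPlace W τ (p^k) hfix : H¹(K_λ, E[p^k]) → H¹(K_λ, E[p^k])` is `localConjH1` along the adapted pair
`(τ̃, Θ) = (liftAutPlace τ hfix, ringEquivLift θ)`, `θ = galAdicCompletionEquiv τ hfix : L ≃+* L`; on
cocycles `[ψ] ↦ [g ↦ τ̃_* ψ(Θ⁻¹ g Θ)]`.
* `galoisRep_toLocal_apply_eq_self` — `Γ_{K_λ}` acts TRIVIALLY on `E[p^k]` (brick C at the prime
  `𝔓₀ = adicCompletionPrime K w`, `G_{𝔓₀} = res Γ_{K_λ}`);
* `map_mem_absIntegers_ringEquivLift` — `Θ^{±1}` preserve the absolute integers `S` of `\bar K_λ`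
  (`θ` is an isometry: `valued_galAdicCompletionMap`; [AbsAnab] transport `map_mem_absIntegers`);
* `isFrobPow_conjGalCMH` — `Θ⁻¹(·)Θ` preserves Frobenius powers of every degree, in particular
  arithmetic Frobenius elements and the inertia group (`isFrobPow_of_semilinear_conj`);
* **`natCard_unramified_inf_ker_conjActPlace_eq`** — for every `s : ℤ`:
  `#(H¹_ur(K_λ, E[p^k]) ∩ ker(σ_{*,λ} − s)) = #ker(τ̃_* − s | E[p^k](K̄))`
  (brick E `natCard_unramifiedSubgroup_inf_ker_eq_natCard_ker`).
Jetchev 2008 §3.2 (2): `τ` acts on `H¹_f(K_λ, E[p^k]) ≅ E[p^k]` through its action on `E[p^k]`.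
What is NOT here: the count `#ker(τ̃_* − s) = p^k` (brick D) and `Kum_λ = H¹_ur` (brick F).

References (locators only; no cited FACT is declared): [cite: Jetchev2008, §3.2 (2) (p. 815)]
[cite: CasselsFrohlichANT1967, Ch. VII §1.1] [cite: NeukirchANT1999, Ch. II §9 Prop. (9.6), Ch. IV
Prop. (5.8)] [cite: SerreLocalFields1979, Ch. II §2 Prop. 3]. Design: no definitions; `K : Type`.
Axioms: `propext`, `Classical.choice`, `Quot.sound`.
-/

set_option autoImplicit false

noncomputable section

open scoped Classical Pointwise NumberField
open WeierstrassCurve Field Function NumberField IsDedekindDomain ValuativeRel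
open Literature.NumberTheory.EllipticCurves Literature.NumberTheory.GaloisRepresentations
open Literature.NumberTheory.GaloisRepresentations.IsNonarchimedeanLocalField
open Literature.NumberTheory.Automorphic
open Literature.AnabelianGeometry.AbsoluteAnabelian

namespace Summit.BirchSwinnertonDyer.Rank1Residual.JET.GlobalDuality

section ConjActUnramified

variable (W : WeierstrassCurve ℚ) (K : Type) [Field K] [NumberField K] [W.IsElliptic] [W.IsGloballyMinimal]

/-- **`Γ_{K_λ}` acts trivially on `E[p^k]`** at a Zhang–Kolyvagin prime `ℓ` with `k ≤ M(ℓ)` (`K`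
imaginary quadratic, `λ ∋ ℓ`): the local module `E[p^k]|_{Γ_{K_λ}}` is `E[p^k](K̄)` with `g` acting
through `res g ∈ G_{𝔓₀} = res Γ_{K_λ}` (`𝔓₀ = adicCompletionPrime K λ`), and `G_{𝔓₀}` fixes
`E[p^k](K̄)` (brick C). McCallum Prop. 4.4 (proof): «`E_{p^M} ⊂ E(K_λ)`».
[cite: McCallumLMS1991, Prop. 4.4 (proof)] [cite: NeukirchANT1999, Ch. II §9 Prop. (9.6)] -/
theorem galoisRep_toLocal_apply_eq_self (hK : IsImaginaryQuadratic K) {p : ℕ} [Fact p.Prime]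
    {k ℓ : ℕ} (hℓ : Zhang2014.IsKolyvaginPrime (W.conductorNorm ℤ) W K p ℓ)
    (hk : k ≤ Zhang2014.kolyvaginIndex W p ℓ)
    (w : HeightOneSpectrum (𝓞 K)) (hw : (ℓ : 𝓞 K) ∈ w.asIdeal)
    (g : absoluteGaloisGroup (w.adicCompletion K)) (Q : geomTorsion (W.baseChange K) ((p ^ k : ℕ) : ℤ)) :
    GaloisRep.toLocal w ((W.baseChange K).torsionGaloisModule ((p ^ k : ℕ) : ℤ)) g Q = Q := by
  change absGaloisRestrict K (w.adicCompletion K) g • Q = Q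
  have hd : absGaloisRestrict K (w.adicCompletion K) g ∈
      (adicCompletionPrime K w).decompositionSubgroup (absoluteGaloisGroup K) := by
    rw [decompositionSubgroup_adicCompletionPrime_eq_range]
    exact ⟨g, rfl⟩
  exact smul_torsion_eq_self_of_mem_decompositionSubgroup W K hK hℓ hk w hw
    (adicCompletionPrime_mem_primesAbove K w) hd Q

omit [W.IsElliptic] [W.IsGloballyMinimal] in
/-- **The Galois transport `θ : K_v ≃ K_{σ v}`... here `θ : K_w ≃+* K_w` for `σ • w = w` — and its
inverse — preserve the valuation of the local field `K_w`** (`valued_galAdicCompletionMap`,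
transferred to the `ValuativeRel` valuation, which is equivalent to `Valued.v`).
[cite: CasselsFrohlichANT1967, Ch. VII §1.1] -/
theorem valuation_galAdicCompletionEquiv (σ : K ≃ₐ[ℚ] K) {w : HeightOneSpectrum (𝓞 K)} (h : σ • w = w)
    (x : w.adicCompletion K) :
    valuation (w.adicCompletion K) (galAdicCompletionEquiv (L := K) σ h x) =
      valuation (w.adicCompletion K) x := by
  rw [(ValuativeRel.isEquiv (valuation (w.adicCompletion K))
      (Valued.v : Valuation (w.adicCompletion K) (WithZero (Multiplicative ℤ)))).eq_iff,
    coe_galAdicCompletionEquiv, valued_galAdicCompletionMap]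

omit [W.IsElliptic] [W.IsGloballyMinimal] in
/-- **A lift `Θ` of the Galois transport `θ` of `K_w` to `\bar K_w`, and its inverse, preserve the
absolute integers `S ⊆ \bar K_w`** (integral closure of `𝒪_{K_w}`): `θ^{±1}` preserve `𝒪_{K_w}`.
[cite: NeukirchANT1999, Ch. IV Prop. (5.8)] -/
theorem map_mem_absIntegers_of_isLiftOfRingEquiv (σ : K ≃ₐ[ℚ] K) {w : HeightOneSpectrum (𝓞 K)}
    (h : σ • w = w) {Θ : AlgebraicClosure (w.adicCompletion K) ≃+* AlgebraicClosure (w.adicCompletion K)}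
    (hΘ : IsLiftOfRingEquiv (galAdicCompletionEquiv (L := K) σ h) Θ) :
    (∀ y ∈ absIntegers 𝒪[w.adicCompletion K] (w.adicCompletion K),
        Θ y ∈ absIntegers 𝒪[w.adicCompletion K] (w.adicCompletion K)) ∧
      ∀ y ∈ absIntegers 𝒪[w.adicCompletion K] (w.adicCompletion K),
        Θ.symm y ∈ absIntegers 𝒪[w.adicCompletion K] (w.adicCompletion K) := by
  refine ⟨fun y hy => map_mem_absIntegers (γ := galAdicCompletionEquiv (L := K) σ h)
      (valuation_galAdicCompletionEquiv K σ h) hΘ hy,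
    fun y hy => map_mem_absIntegers (γ := (galAdicCompletionEquiv (L := K) σ h).symm) (fun x => ?_)
      hΘ.symm hy⟩
  conv_rhs => rw [← (galAdicCompletionEquiv (L := K) σ h).apply_symm_apply x]
  exact (valuation_galAdicCompletionEquiv K σ h _).symm

omit [W.IsElliptic] [W.IsGloballyMinimal] in
/-- **Conjugation `g ↦ Θ⁻¹ g Θ` by a lift of the Galois transport preserves Frobenius powers of
every degree** (`[AbsAnab]` transport `isFrobPow_of_semilinear_conj` for the `θ⁻¹`-semilinear
`Θ⁻¹`): in particular it carries arithmetic Frobenius elements to arithmetic Frobenius elements and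
the inertia group into itself. [cite: NeukirchANT1999, Ch. IV Prop. (5.8)]
[cite: SerreLocalFields1979, Ch. II §2 Prop. 3] -/
theorem isFrobPow_conjGalCMH (σ : K ≃ₐ[ℚ] K) {w : HeightOneSpectrum (𝓞 K)} (h : σ • w = w)
    {Θ : AlgebraicClosure (w.adicCompletion K) ≃+* AlgebraicClosure (w.adicCompletion K)}
    (hΘ : IsLiftOfRingEquiv (galAdicCompletionEquiv (L := K) σ h) Θ)
    {g : absoluteGaloisGroup (w.adicCompletion K)} {n : ℤ} (hg : IsFrobPow g n) :
    IsFrobPow (hΘ.conjGalCMH g) n := by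
  obtain ⟨hS, hS'⟩ := map_mem_absIntegers_of_isLiftOfRingEquiv K σ h hΘ
  refine isFrobPow_of_semilinear_conj (φ := Θ.symm) hS' (fun y hy => ?_) (fun z => ?_) hg
  · rw [RingEquiv.symm_symm]; exact hS y hy
  · change Θ.symm ((show AlgebraicClosure (w.adicCompletion K) ≃ₐ[w.adicCompletion K]
        AlgebraicClosure (w.adicCompletion K) from g) (Θ (Θ.symm z))) = Θ.symm (g • z)
    rw [Θ.apply_symm_apply]
    rfl

/-- **The `s`-eigenspace of `σ_{*,λ}` on `H¹_ur(K_λ, E[p^k])` is counted on `E[p^k](K̄)` through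
the adapted lift `τ̃ = liftAutPlace τ hfix`**: for every `s : ℤ`,
`#(H¹_ur(K_λ, E[p^k]) ∩ ker(conjActPlace − s)) = #ker(τ̃_* − s | E[p^k](K̄))` — brick E with
`T = conjActPlace` (`[ψ] ↦ [g ↦ τ̃_* ψ(Θ⁻¹ g Θ)]`, `localConjH1_oneCocycleClass`), `t = τ̃_*`
(`IsLiftOfAut.torsionMap`), `f = Θ⁻¹(·)Θ` (`isFrobPow_conjGalCMH`), trivial action
(`galoisRep_toLocal_apply_eq_self`). Jetchev 2008 §3.2 (2). [cite: Jetchev2008, §3.2 (2) (p. 815)]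
[cite: CasselsFrohlichANT1967, Ch. VII §1.1] -/
theorem natCard_unramified_inf_ker_conjActPlace_eq (hK : IsImaginaryQuadratic K) {p : ℕ} [Fact p.Prime]
    {k ℓ : ℕ} (hℓ : Zhang2014.IsKolyvaginPrime (W.conductorNorm ℤ) W K p ℓ)
    (hk : k ≤ Zhang2014.kolyvaginIndex W p ℓ)
    (w : HeightOneSpectrum (𝓞 K)) (hw : (ℓ : 𝓞 K) ∈ w.asIdeal) (τ : K ≃ₐ[ℚ] K) (hfix : τ • w = w)
    (s : ℤ) :
    Nat.card ↥(DiscreteGaloisModule.unramifiedSubgroup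
        (GaloisRep.toLocal w ((W.baseChange K).torsionGaloisModule ((p ^ k : ℕ) : ℤ))) 1 ⊓
      (conjActPlace W τ ((p ^ k : ℕ) : ℤ) hfix - s • AddMonoidHom.id _).ker) =
    Nat.card ((isLiftOfAut_liftAutPlace τ hfix).torsionMap W ((p ^ k : ℕ) : ℤ) -
      s • AddMonoidHom.id _).ker := by
  have hp : p.Prime := Fact.out
  set L := w.adicCompletion K with hL
  set n : ℤ := ((p ^ k : ℕ) : ℤ) with hn
  haveI : Finite (geomTorsion (W.baseChange K) n) :=
    finite_torsionPoints_holds (W.baseChange K) (AlgebraicClosure K) (by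
      rw [hn]; exact_mod_cast pow_ne_zero k hp.ne_zero)
  set ρ := GaloisRep.toLocal w ((W.baseChange K).torsionGaloisModule n) with hρ
  -- a local Frobenius
  obtain ⟨φ, hφ⟩ := exists_isAbsArithFrob_holds L
  have hφ1 : IsFrobPow φ 1 := IsAbsArithFrob.isFrobPow_holds hφ
  -- the adapted pair
  set hτ := isLiftOfAut_liftAutPlace τ hfix with hτdef
  set hΘ := isLiftOfRingEquiv_ringEquivLift (galAdicCompletionEquiv (L := K) τ hfix) with hΘdef
  set hc := liftsCommute_liftAutPlace τ hfix with hcdef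
  refine natCard_unramifiedSubgroup_inf_ker_eq_natCard_ker ρ
    (galoisRep_toLocal_apply_eq_self W K hK hℓ hk w hw) hφ1
    (conjActPlace W τ n hfix) (hτ.torsionMap W n) (fun g => hΘ.conjGalCMH g) (fun ψ => ?_)
    (isFrobPow_conjGalCMH K τ hfix hΘ hφ1) (fun i hi => ?_) s
  · refine ⟨contOneCocycles.pullback hΘ.conjGalCMH (localConjHom W hτ hΘ hc n) ψ, ?_, fun g => ?_⟩
    · exact localConjH1_oneCocycleClass W hτ hΘ hc n ψ
    · rw [contOneCocycles.pullback_apply]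
      rfl
  · rw [← isFrobPow_zero_iff_mem_absInertia] at hi ⊢
    exact isFrobPow_conjGalCMH K τ hfix hΘ hi

end ConjActUnramified

end Summit.BirchSwinnertonDyer.Rank1Residual.JET.GlobalDuality

end
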